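import Mathlib
import Literature.MeasureTheory.Integral.HPolyhedronFacetSum
import HarnessLib

/-!
# Gauss–Green, vertical component, for an H-polyhedron in FACET-CHART form (brick T1(i), assembly)

Topic `Literature/MeasureTheory/Integral`; namespace `Literature.MeasureTheory.Integral`.
Assembly of `setIntegral_deriv_hPolyhedron_eq_sum` (L3, `HPolyhedronTopFacets`) with the piece ↔ chart
identifications of `HPolyhedronFacetSum`: for the H-polyhedron
`P = {(x,t) | ∀ j ∈ J, α_j x₁ + β_j x₂ + c_j t ≤ b_j}` (bounded above and below in `t`, distinct
non-vertical constraint planes), isometric charts `φ_j y = p₀ⱼ + y₁uⱼ + y₂vⱼ` of the constraint planes and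
`g` with `∂_t g = g'`:
`∫_P g' = Σ_{j ∈ J, c_j ≠ 0} (c_j/√(α_j²+β_j²+c_j²)) · ∫ 1_P(φ_j y) g(φ_j y) dy`
(`setIntegral_deriv_hPolyhedron_eq_facetSum`).  The `j`-th integral is the integral of `g` over the
`j`-th FACET `P ∩ Π_j` in an isometric chart, and `c_j/‖n_j‖ = ⟪ν_j, e_t⟫` is the vertical component
of the outer unit normal — i.e. this is `∫_P ∂_t g = Σ_F ∫_F g ⟪ν_F, e_t⟫ dσ`, the vertical component of
the Gauss–Green formula for convex polyhedra (vertical facets, `c_j = 0`, contribute nothing).  Summing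
the three coordinate directions (brick T1) is not done here; integrability side conditions are carried
as hypotheses exactly as in L3.
-/

noncomputable section

namespace Literature.MeasureTheory.Integral

open _root_.MeasureTheory Set Finset

variable {ι : Type*} [LinearOrder ι]

/-- **Vertical Gauss–Green for an H-polyhedron, facet-chart form.**  See the module docstring.
[cite: EvansGariepy2015, Thm 5.16 (Gauss–Green), polyhedral case, vertical component] -/
theorem setIntegral_deriv_hPolyhedron_eq_facetSum {J : Finset ι} (α β c b : ι → ℝ)
    (hup : (J.filter fun j => 0 < c j).Nonempty) (hlow : (J.filter fun j => c j < 0).Nonempty)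
    (hnd : ∀ j ∈ J, ∀ k ∈ J, j ≠ k → c j ≠ 0 → c k ≠ 0 →
      ∃ x : ℝ × ℝ, (b j - α j * x.1 - β j * x.2) / c j ≠ (b k - α k * x.1 - β k * x.2) / c k)
    (p₀ u v : ι → (ℝ × ℝ) × ℝ)
    (hp₀ : ∀ j ∈ J, c j ≠ 0 → α j * (p₀ j).1.1 + β j * (p₀ j).1.2 + c j * (p₀ j).2 = b j)
    (hnu : ∀ j ∈ J, c j ≠ 0 → α j * (u j).1.1 + β j * (u j).1.2 + c j * (u j).2 = 0)
    (hnv : ∀ j ∈ J, c j ≠ 0 → α j * (v j).1.1 + β j * (v j).1.2 + c j * (v j).2 = 0)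
    (hu1 : ∀ j ∈ J, c j ≠ 0 → (u j).1.1 ^ 2 + (u j).1.2 ^ 2 + (u j).2 ^ 2 = 1)
    (hv1 : ∀ j ∈ J, c j ≠ 0 → (v j).1.1 ^ 2 + (v j).1.2 ^ 2 + (v j).2 ^ 2 = 1)
    (huv : ∀ j ∈ J, c j ≠ 0 →
      (u j).1.1 * (v j).1.1 + (u j).1.2 * (v j).1.2 + (u j).2 * (v j).2 = 0)
    {g g' : (ℝ × ℝ) × ℝ → ℝ}
    (hderiv : ∀ x t, HasDerivAt (fun s => g (x, s)) (g' (x, t)) t) (hcont : Continuous g')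
    (hint : IntegrableOn g'
      {p : (ℝ × ℝ) × ℝ | ∀ j ∈ J, α j * p.1.1 + β j * p.1.2 + c j * p.2 ≤ b j} volume)
    (hghi : IntegrableOn (fun x : ℝ × ℝ => g (x, (J.filter fun j => 0 < c j).inf' hup
        (fun j => (b j - (α j * x.1 + β j * x.2)) / c j)))
      {x : ℝ × ℝ | (∀ j ∈ J, c j = 0 → α j * x.1 + β j * x.2 ≤ b j) ∧
        (J.filter fun j => c j < 0).sup' hlow (fun j => (b j - (α j * x.1 + β j * x.2)) / c j) ≤
          (J.filter fun j => 0 < c j).inf' hup (fun j => (b j - (α j * x.1 + β j * x.2)) / c j)}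
      volume)
    (hglo : IntegrableOn (fun x : ℝ × ℝ => g (x, (J.filter fun j => c j < 0).sup' hlow
        (fun j => (b j - (α j * x.1 + β j * x.2)) / c j)))
      {x : ℝ × ℝ | (∀ j ∈ J, c j = 0 → α j * x.1 + β j * x.2 ≤ b j) ∧
        (J.filter fun j => c j < 0).sup' hlow (fun j => (b j - (α j * x.1 + β j * x.2)) / c j) ≤
          (J.filter fun j => 0 < c j).inf' hup (fun j => (b j - (α j * x.1 + β j * x.2)) / c j)}
      volume) :
    ∫ p in {p : (ℝ × ℝ) × ℝ | ∀ j ∈ J, α j * p.1.1 + β j * p.1.2 + c j * p.2 ≤ b j}, g' p =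
      ∑ j ∈ J.filter (fun j => c j ≠ 0), c j / Real.sqrt (α j ^ 2 + β j ^ 2 + c j ^ 2) *
        ∫ y : ℝ × ℝ, {p : (ℝ × ℝ) × ℝ | ∀ k ∈ J, α k * p.1.1 + β k * p.1.2 + c k * p.2 ≤ b k}.indicator
          (fun _ => (1 : ℝ)) (p₀ j + y.1 • u j + y.2 • v j) * g (p₀ j + y.1 • u j + y.2 • v j) := by
  classical
  have hA : ∀ k, Continuous (fun x : ℝ × ℝ => α k * x.1 + β k * x.2) := fun k => by fun_prop
  have hL3 := setIntegral_deriv_hPolyhedron_eq_sum (A := fun k (x : ℝ × ℝ) => α k * x.1 + β k * x.2)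
    hA c b hup hlow hderiv hcont hint hghi hglo
  rw [hL3]
  have hsplit : J.filter (fun j => c j ≠ 0) =
      J.filter (fun j => 0 < c j) ∪ J.filter (fun j => c j < 0) := by
    ext j
    simp only [Finset.mem_filter, Finset.mem_union]
    constructor
    · rintro ⟨hj, hc⟩
      rcases lt_or_gt_of_ne hc with h | h
      · exact Or.inr ⟨hj, h⟩
      · exact Or.inl ⟨hj, h⟩
    · rintro (⟨hj, h⟩ | ⟨hj, h⟩)
      · exact ⟨hj, h.ne'⟩
      · exact ⟨hj, h.ne⟩
  have hdisj : Disjoint (J.filter fun j => 0 < c j) (J.filter fun j => c j < 0) := by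
    rw [Finset.disjoint_filter]
    intro j _ h1 h2
    exact lt_asymm h1 h2
  rw [hsplit, Finset.sum_union hdisj, sub_eq_add_neg, ← Finset.sum_neg_distrib]
  congr 1
  · refine Finset.sum_congr rfl fun j hj => ?_
    have hj' := Finset.mem_filter.1 hj
    have hc0 : c j ≠ 0 := hj'.2.ne'
    exact setIntegral_upperPiece_eq_chart α β c b hup hlow hj'.1 hj'.2
      (fun k hk hkj hck => hnd j hj'.1 k hk (fun h => hkj h.symm) hc0 hck.ne') (p₀ j) (u j) (v j)
      (hp₀ j hj'.1 hc0) (hnu j hj'.1 hc0) (hnv j hj'.1 hc0) (hu1 j hj'.1 hc0) (hv1 j hj'.1 hc0)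
      (huv j hj'.1 hc0) g
  · refine Finset.sum_congr rfl fun j hj => ?_
    have hj' := Finset.mem_filter.1 hj
    have hc0 : c j ≠ 0 := hj'.2.ne
    have h := setIntegral_lowerPiece_eq_chart α β c b hup hlow hj'.1 hj'.2
      (fun k hk hkj hck => hnd j hj'.1 k hk (fun h => hkj h.symm) hc0 hck.ne) (p₀ j) (u j) (v j)
      (hp₀ j hj'.1 hc0) (hnu j hj'.1 hc0) (hnv j hj'.1 hc0) (hu1 j hj'.1 hc0) (hv1 j hj'.1 hc0)
      (huv j hj'.1 hc0) g
    rw [h]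
    ring

end Literature.MeasureTheory.Integral

end
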